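import Mathlib
import Summits.KontsevichZagierPeriods.KontsevichZagierPeriods.Theorems.IsogenyCertificatesRichelotChainTransfer
import Summits.KontsevichZagierPeriods.KontsevichZagierPeriods.Theorems.IsogenyCertificatesRichelotChainQuad

/-!
# `RichelotChain` (stmt-KontsevichZagierPeriods-6732, route IsogenyCertificates): transfer along one correspondence

The generic engine of the five identities. A (2,2)-correspondence is given by a function
`Φ(y, t) = a(t)y² + b(t)y + c(t) = P(y)t² + Q(y)t + R(y)` (both expansions as hypotheses, with the
`t`-derivatives `a₁, b₁, c₁` of `a, b, c`), a "norm" identity `F_T(y)F_S(t) = Ψ(y,t)²` and a "trace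
certificate" `F_T(y)∂_yΦ + κ(P(y)(y + t) + Q(y))Ψ = 0`, both on `Φ = 0` (for the Richelot pair these
are `cert*_norm`, `cert*_trace_*` of `…RichelotChainCerts`). Over a source interval `(lo, hi)` cut at
`mid` and a target interval `T = (y₁, y₂)` we assume the real picture established numerically in the
session and proved interval by interval in the `…Sheet*` files: the discriminant in `y` is positive,
`a > 0`, for every source point the quadratic `Φ(·, t)` has one root in `T` and one in a disjoint
interval `T′` (on the side recorded by the sign `ε`), and for every target point `y` the quadratic
`Φ(y, ·)` has one root in `(lo, mid)` below `y` and one in `(mid, hi)` above `y`. Then the branch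
`ψ = (−b + ε√disc)/(2a)` realises the hypotheses of the two-sheet transfer
(`two_sheet_transfer`) with the trace identity supplied by `trace_from_certs`, and
`[(lo,hi), c_g(α + βt)/√|F_S|] ~ [T, c_f(α + βy)/√|F_T|]` whenever `c_f = c_g|κ|`.

References: J.-B. Bost, J.-F. Mestre, Gaz. Math. 38 (1988), §2; M. Kontsevich, D. Zagier, *Periods*
(2001), §1.2.
-/

noncomputable section

open Set MeasureTheory
open Literature.NumberTheory.Transcendental Literature.ModelTheory.ExponentialFields

namespace Summit.KontsevichZagierPeriods.IsogenyCertificates.RichelotChain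

/-- Root selection by side: if `a > 0`, `disc > 0`, `y, y′` are roots of `ay² + by + c` and
`ε(y − y′) > 0` with `ε = ±1`, then `y` is the root `(−b + ε√disc)/(2a)`. [folklore] -/
theorem root_eq_quadRoot_of_sep (a b c y y' ε : ℝ) (ha : 0 < a) (hD : 0 < b ^ 2 - 4 * a * c)
    (hy : a * y ^ 2 + b * y + c = 0) (hy' : a * y' ^ 2 + b * y' + c = 0) (hε : ε = -1 ∨ ε = 1)
    (hsep : 0 < ε * (y - y')) : y = (-b + ε * Real.sqrt (b ^ 2 - 4 * a * c)) / (2 * a) := by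
  rcases hε with rfl | rfl
  · have hlt : y < y' := by linarith
    exact (roots_eq_of_lt a b c y y' ha hD hy hy' hlt).1
  · have hlt : y' < y := by linarith
    exact (roots_eq_of_lt a b c y' y ha hD hy' hy hlt).2

/-- A quadratic polynomial function `u ↦ pu² + qu + r` has derivative `2pt + q`. [folklore] -/
theorem hasDerivAt_quad (p q r t : ℝ) {f : ℝ → ℝ} (hf : ∀ u, f u = p * u ^ 2 + q * u + r) :
    HasDerivAt f (2 * p * t + q) t := by
  have h := ((((hasDerivAt_id t).fun_mul (hasDerivAt_id t)).const_mul p).fun_add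
    ((hasDerivAt_id t).const_mul q)).fun_add (hasDerivAt_const t r)
  have e : f = fun u => p * (id u * id u) + q * id u + r := by
    funext u
    rw [hf u]
    simp only [id]
    ring
  rw [e]
  exact h.congr_deriv (by simp only [id]; ring)

/-- **Transfer along one real two-sheeted correspondence** (see the module docstring for the
hypotheses). [cite: BostMestre1988, §2] -/
theorem correspondence_transfer (a b c a₁ b₁ c₁ P Q R Ft Fs : ℝ → ℝ) (Ψ : ℝ → ℝ → ℝ)
    (κ cf cg α β : ℝ) (ε : ℚ) (lo mid hi y₁ y₂ y₁' y₂' : ℚ) (r s : KZ.IntegralRep 1)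
    (hε : ε = -1 ∨ ε = 1) (hlm : lo < mid) (hmh : mid < hi)
    (hexp : ∀ y t : ℝ, a t * y ^ 2 + b t * y + c t = P y * t ^ 2 + Q y * t + R y)
    (hda : ∀ t, HasDerivAt a (a₁ t) t) (hdb : ∀ t, HasDerivAt b (b₁ t) t)
    (hdc : ∀ t, HasDerivAt c (c₁ t) t)
    (hsa : ∀ σ : Set (Fin 1 → ℝ), IsSemialgebraic ℚ σ → IsSemialgebraicFunOn ℚ σ (fun p => a (p 0)))
    (hsb : ∀ σ : Set (Fin 1 → ℝ), IsSemialgebraic ℚ σ → IsSemialgebraicFunOn ℚ σ (fun p => b (p 0)))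
    (hsc : ∀ σ : Set (Fin 1 → ℝ), IsSemialgebraic ℚ σ → IsSemialgebraicFunOn ℚ σ (fun p => c (p 0)))
    (hsa₁ : ∀ σ : Set (Fin 1 → ℝ), IsSemialgebraic ℚ σ → IsSemialgebraicFunOn ℚ σ (fun p => a₁ (p 0)))
    (hsb₁ : ∀ σ : Set (Fin 1 → ℝ), IsSemialgebraic ℚ σ → IsSemialgebraicFunOn ℚ σ (fun p => b₁ (p 0)))
    (hsc₁ : ∀ σ : Set (Fin 1 → ℝ), IsSemialgebraic ℚ σ → IsSemialgebraicFunOn ℚ σ (fun p => c₁ (p 0)))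
    (hnorm : ∀ y t : ℝ, a t * y ^ 2 + b t * y + c t = 0 → Ft y * Fs t = Ψ y t ^ 2)
    (hcert : ∀ y t : ℝ, a t * y ^ 2 + b t * y + c t = 0 →
      Ft y * (2 * a t * y + b t) + κ * (P y * (y + t) + Q y) * Ψ y t = 0)
    (hq : cf = cg * |κ|)
    (ha : ∀ t : ℝ, (lo : ℝ) < t → t < hi → 0 < a t)
    (hd : ∀ t : ℝ, (lo : ℝ) < t → t < hi → t ≠ mid → 0 < b t ^ 2 - 4 * a t * c t)
    (hyroots : ∀ t : ℝ, (lo : ℝ) < t → t < hi → t ≠ mid →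
      (∃ y : ℝ, (y₁ : ℝ) < y ∧ y < y₂ ∧ a t * y ^ 2 + b t * y + c t = 0) ∧
        ∃ y' : ℝ, (y₁' : ℝ) < y' ∧ y' < y₂' ∧ a t * y' ^ 2 + b t * y' + c t = 0)
    (hsep : ∀ y y' : ℝ, (y₁ : ℝ) < y → y < y₂ → (y₁' : ℝ) < y' → y' < y₂' → 0 < (ε : ℝ) * (y - y'))
    (hP : ∀ y : ℝ, (y₁ : ℝ) < y → y < y₂ → P y ≠ 0)
    (htroots : ∀ y : ℝ, (y₁ : ℝ) < y → y < y₂ →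
      (∃ t : ℝ, (lo : ℝ) < t ∧ t < mid ∧ t < y ∧ a t * y ^ 2 + b t * y + c t = 0) ∧
        ∃ t : ℝ, (mid : ℝ) < t ∧ t < hi ∧ y < t ∧ a t * y ^ 2 + b t * y + c t = 0)
    (hDz : ∀ y : ℝ, (y₁ : ℝ) < y → y < y₂ → Q y ^ 2 - 4 * P y * R y ≠ 0)
    (hFt : ∀ y : ℝ, (y₁ : ℝ) < y → y < y₂ → Ft y ≠ 0)
    (hFs : ∀ t : ℝ, (lo : ℝ) < t → t < hi → t ≠ mid → Fs t ≠ 0)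
    (hr : r.domain = {p | (lo : ℝ) < p 0 ∧ p 0 < (hi : ℝ)})
    (hg : EqOn r.integrand (fun p => cg * (α + β * p 0) / Real.sqrt |Fs (p 0)|) r.domain)
    (hs : s.domain = {p | (y₁ : ℝ) < p 0 ∧ p 0 < (y₂ : ℝ)})
    (hf : EqOn s.integrand (fun p => cf * (α + β * p 0) / Real.sqrt |Ft (p 0)|) s.domain) :
    KZ.Equivalent r s := by
  have hlm' : (lo : ℝ) < mid := by exact_mod_cast hlm
  have hmh' : (mid : ℝ) < hi := by exact_mod_cast hmh
  have hε' : (ε : ℝ) = -1 ∨ (ε : ℝ) = 1 := by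
    rcases hε with h | h
    · left; rw [h]; norm_num
    · right; rw [h]; norm_num
  have hε2 : (ε : ℝ) ^ 2 = 1 := by rcases hε' with h | h <;> rw [h] <;> norm_num
  have hε0 : (ε : ℝ) ≠ 0 := by rcases hε' with h | h <;> rw [h] <;> norm_num
  -- the branch and its implicit derivative
  set ψ : ℝ → ℝ := fun t => (-b t + (ε : ℝ) * Real.sqrt (b t ^ 2 - 4 * a t * c t)) / (2 * a t)
    with hψ_def
  set ψ' : ℝ → ℝ := fun t => -(a₁ t * ψ t ^ 2 + b₁ t * ψ t + c₁ t) / (2 * a t * ψ t + b t)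
    with hψ'_def
  -- the t-derivative of Φ: a₁ y² + b₁ y + c₁ = 2 P t + Q
  have hexp_t : ∀ y t : ℝ, a₁ t * y ^ 2 + b₁ t * y + c₁ t = 2 * P y * t + Q y := by
    intro y t
    have h1 : HasDerivAt (fun u => a u * y ^ 2 + b u * y + c u) (a₁ t * y ^ 2 + b₁ t * y + c₁ t) t :=
      (((hda t).mul_const (y ^ 2)).fun_add ((hdb t).mul_const y)).fun_add (hdc t)
    have h2 : HasDerivAt (fun u => a u * y ^ 2 + b u * y + c u) (2 * P y * t + Q y) t :=
      hasDerivAt_quad (P y) (Q y) (R y) t fun u => hexp y u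
    exact h1.unique h2
  -- Step A: root selection in the target variable
  have hA : ∀ t : ℝ, (lo : ℝ) < t → t < hi → t ≠ mid →
      a t * ψ t ^ 2 + b t * ψ t + c t = 0 ∧ ((y₁ : ℝ) < ψ t ∧ ψ t < y₂) ∧
        ∀ w : ℝ, (y₁ : ℝ) < w → w < y₂ → a t * w ^ 2 + b t * w + c t = 0 → w = ψ t := by
    intro t h1 h2 h3
    have hat := ha t h1 h2
    have hdt := hd t h1 h2 h3
    obtain ⟨⟨y, hy1, hy2, hy⟩, ⟨y', hy1', hy2', hy'⟩⟩ := hyroots t h1 h2 h3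
    have hsel : ∀ w : ℝ, (y₁ : ℝ) < w → w < y₂ → a t * w ^ 2 + b t * w + c t = 0 → w = ψ t :=
      fun w hw1 hw2 hw => root_eq_quadRoot_of_sep (a t) (b t) (c t) w y' ε hat hdt hw hy' hε'
        (hsep w y' hw1 hw2 hy1' hy2')
    have hyψ : y = ψ t := hsel y hy1 hy2 hy
    refine ⟨?_, ⟨hyψ ▸ hy1, hyψ ▸ hy2⟩, hsel⟩
    exact quadRoot_isRoot (a t) (b t) (c t) ε hat.ne' hdt.le hε2
  -- Step B: the two roots in the source variable over a target point
  have hB : ∀ y : ℝ, (y₁ : ℝ) < y → y < y₂ → ∃ u₀ u₁ : ℝ,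
      ((lo : ℝ) < u₀ ∧ u₀ < mid ∧ u₀ < y ∧ a u₀ * y ^ 2 + b u₀ * y + c u₀ = 0) ∧
      ((mid : ℝ) < u₁ ∧ u₁ < hi ∧ y < u₁ ∧ a u₁ * y ^ 2 + b u₁ * y + c u₁ = 0) ∧
      P y * (u₀ + u₁) + Q y = 0 ∧
      ∀ t : ℝ, a t * y ^ 2 + b t * y + c t = 0 → t = u₀ ∨ t = u₁ := by
    intro y h1 h2
    obtain ⟨⟨u₀, hu₀⟩, ⟨u₁, hu₁⟩⟩ := htroots y h1 h2
    have hPy := hP y h1 h2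
    have hr₀ : P y * u₀ ^ 2 + Q y * u₀ + R y = 0 := by rw [← hexp]; exact hu₀.2.2.2
    have hr₁ : P y * u₁ ^ 2 + Q y * u₁ + R y = 0 := by rw [← hexp]; exact hu₁.2.2.2
    have hne : u₁ ≠ u₀ := by intro h; linarith [hu₀.2.2.1, hu₁.2.2.1]
    have hu₁' : u₁ = -Q y / P y - u₀ :=
      (root_cases (P y) (Q y) (R y) u₀ u₁ hPy hr₀ hr₁).resolve_left hne
    refine ⟨u₀, u₁, hu₀, hu₁, ?_, fun t ht => ?_⟩
    · rw [hu₁']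
      field_simp
      ring
    · have hrt : P y * t ^ 2 + Q y * t + R y = 0 := by rw [← hexp]; exact ht
      rcases root_cases (P y) (Q y) (R y) u₀ t hPy hr₀ hrt with h | h
      · exact Or.inl h
      · exact Or.inr (h.trans hu₁'.symm)
  -- consequences: classification of source roots lying in the two pieces
  have hB₀ : ∀ y t : ℝ, (y₁ : ℝ) < y → y < y₂ → (lo : ℝ) < t → t < mid →
      a t * y ^ 2 + b t * y + c t = 0 → t < y ∧ ∀ t' : ℝ, (lo : ℝ) < t' → t' < mid →
        a t' * y ^ 2 + b t' * y + c t' = 0 → t' = t := by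
    intro y t h1 h2 h3 h4 ht
    obtain ⟨u₀, u₁, hu₀, hu₁, -, hcl⟩ := hB y h1 h2
    have key : ∀ w : ℝ, (lo : ℝ) < w → w < mid → a w * y ^ 2 + b w * y + c w = 0 → w = u₀ := by
      intro w hw1 hw2 hw
      rcases hcl w hw with h | h
      · exact h
      · exfalso; rw [h] at hw2; linarith [hu₁.1]
    refine ⟨(key t h3 h4 ht) ▸ hu₀.2.2.1, fun t' h3' h4' ht' => ?_⟩
    rw [key t h3 h4 ht, key t' h3' h4' ht']
  have hB₁ : ∀ y t : ℝ, (y₁ : ℝ) < y → y < y₂ → (mid : ℝ) < t → t < hi →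
      a t * y ^ 2 + b t * y + c t = 0 → y < t ∧ ∀ t' : ℝ, (mid : ℝ) < t' → t' < hi →
        a t' * y ^ 2 + b t' * y + c t' = 0 → t' = t := by
    intro y t h1 h2 h3 h4 ht
    obtain ⟨u₀, u₁, hu₀, hu₁, -, hcl⟩ := hB y h1 h2
    have key : ∀ w : ℝ, (mid : ℝ) < w → w < hi → a w * y ^ 2 + b w * y + c w = 0 → w = u₁ := by
      intro w hw1 hw2 hw
      rcases hcl w hw with h | h
      · exfalso; rw [h] at hw1; linarith [hu₀.2.1]
      · exact h
    refine ⟨(key t h3 h4 ht) ▸ hu₁.2.2.1, fun t' h3' h4' ht' => ?_⟩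
    rw [key t h3 h4 ht, key t' h3' h4' ht']
  -- Step C: the hypotheses of the two-sheet transfer, for a piece (u, v) ⊆ (lo, hi) avoiding mid
  have hpiece : ∀ u v : ℚ, lo ≤ u → v ≤ hi → (v ≤ mid ∨ mid ≤ u) →
      IsSemialgebraicFunOn ℚ {p : Fin 1 → ℝ | (u : ℝ) < p 0 ∧ p 0 < (v : ℝ)} (fun p => ψ (p 0)) ∧
      IsSemialgebraicFunOn ℚ {p : Fin 1 → ℝ | (u : ℝ) < p 0 ∧ p 0 < (v : ℝ)} (fun p => ψ' (p 0)) ∧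
      (∀ t : ℝ, (u : ℝ) < t → t < (v : ℝ) → HasDerivAt ψ (ψ' t) t) ∧
      (∀ t : ℝ, (u : ℝ) < t → t < (v : ℝ) → ψ' t ≠ 0) := by
    intro u v hu hv huv
    have hσ := isSemialgebraic_Ioo u v
    have hmem : ∀ t : ℝ, (u : ℝ) < t → t < (v : ℝ) → (lo : ℝ) < t ∧ t < hi ∧ t ≠ mid := by
      intro t h1 h2
      have hu' : ((lo : ℚ) : ℝ) ≤ u := by exact_mod_cast hu
      have hv' : ((v : ℚ) : ℝ) ≤ hi := by exact_mod_cast hv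
      refine ⟨hu'.trans_lt h1, h2.trans_le hv', ?_⟩
      rcases huv with h | h
      · have h' : ((v : ℚ) : ℝ) ≤ mid := by exact_mod_cast h
        exact (h2.trans_le h').ne
      · have h' : ((mid : ℚ) : ℝ) ≤ u := by exact_mod_cast h
        exact (h'.trans_lt h1).ne'
    have hψsa : IsSemialgebraicFunOn ℚ {p : Fin 1 → ℝ | (u : ℝ) < p 0 ∧ p 0 < (v : ℝ)} (fun p => ψ (p 0)) :=
      quadRoot_semialgebraic a b c ε (hsa _ hσ) (hsb _ hσ) (hsc _ hσ)
    refine ⟨hψsa, implicitDeriv_semialgebraic a b a₁ b₁ c₁ ψ (hsa _ hσ) (hsb _ hσ) (hsa₁ _ hσ)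
      (hsb₁ _ hσ) (hsc₁ _ hσ) hψsa, fun t h1 h2 => ?_, fun t h1 h2 => ?_⟩
    · obtain ⟨hl, hh, hm⟩ := hmem t h1 h2
      exact hasDerivAt_quadRoot a b c (a₁ t) (b₁ t) (c₁ t) t ε hε2 (hda t) (hdb t) (hdc t)
        (ha t hl hh).ne' (hd t hl hh hm)
    · obtain ⟨hl, hh, hm⟩ := hmem t h1 h2
      obtain ⟨hroot, ⟨hy1, hy2⟩, -⟩ := hA t hl hh hm
      refine implicitDeriv_ne_zero (a t) (b t) (a₁ t) (b₁ t) (c₁ t) (ψ t) ?_ ?_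
      · -- numerator: ∂_tΦ = 2 P t + Q, and (2Pt + Q)² = Q² − 4PR ≠ 0 on Φ = 0
        rw [hexp_t]
        have hrt : P (ψ t) * t ^ 2 + Q (ψ t) * t + R (ψ t) = 0 := by rw [← hexp]; exact hroot
        have hsq : (2 * P (ψ t) * t + Q (ψ t)) ^ 2 = Q (ψ t) ^ 2 - 4 * P (ψ t) * R (ψ t) := by
          linear_combination 4 * P (ψ t) * hrt
        intro h0
        apply hDz (ψ t) hy1 hy2
        rw [← hsq, h0]
        ring
      · rw [hψ_def, two_mul_quadRoot_add _ _ _ _ (ha t hl hh).ne']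
        exact mul_ne_zero hε0 (Real.sqrt_pos.mpr (hd t hl hh hm)).ne'
  obtain ⟨hψ₀, hψ₀', hd₀, hn₀⟩ := hpiece lo mid le_rfl hmh.le (Or.inl le_rfl)
  obtain ⟨hψ₁, hψ₁', hd₁, hn₁⟩ := hpiece mid hi hlm.le le_rfl (Or.inr le_rfl)
  -- injectivity and images of the two sheets
  have hi₀ : InjOn ψ (Ioo (lo : ℝ) mid) := by
    intro t ht t' ht' h
    obtain ⟨hroot, ⟨hy1, hy2⟩, -⟩ := hA t ht.1 (ht.2.trans hmh') ht.2.ne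
    obtain ⟨hroot', -, -⟩ := hA t' ht'.1 (ht'.2.trans hmh') ht'.2.ne
    rw [← h] at hroot'
    exact ((hB₀ (ψ t) t hy1 hy2 ht.1 ht.2 hroot).2 t' ht'.1 ht'.2 hroot').symm
  have hi₁ : InjOn ψ (Ioo (mid : ℝ) hi) := by
    intro t ht t' ht' h
    obtain ⟨hroot, ⟨hy1, hy2⟩, -⟩ := hA t (hlm'.trans ht.1) ht.2 ht.1.ne'
    obtain ⟨hroot', -, -⟩ := hA t' (hlm'.trans ht'.1) ht'.2 ht'.1.ne'
    rw [← h] at hroot'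
    exact ((hB₁ (ψ t) t hy1 hy2 ht.1 ht.2 hroot).2 t' ht'.1 ht'.2 hroot').symm
  have him₀ : ψ '' Ioo (lo : ℝ) mid = Ioo (y₁ : ℝ) y₂ := by
    ext y
    constructor
    · rintro ⟨t, ht, rfl⟩
      exact (hA t ht.1 (ht.2.trans hmh') ht.2.ne).2.1
    · rintro ⟨h1, h2⟩
      obtain ⟨u₀, u₁, hu₀, -, -, -⟩ := hB y h1 h2
      refine ⟨u₀, ⟨hu₀.1, hu₀.2.1⟩, ?_⟩
      exact ((hA u₀ hu₀.1 (hu₀.2.1.trans hmh') hu₀.2.1.ne).2.2 y h1 h2 hu₀.2.2.2).symm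
  have him₁ : ψ '' Ioo (mid : ℝ) hi = Ioo (y₁ : ℝ) y₂ := by
    ext y
    constructor
    · rintro ⟨t, ht, rfl⟩
      exact (hA t (hlm'.trans ht.1) ht.2 ht.1.ne').2.1
    · rintro ⟨h1, h2⟩
      obtain ⟨u₀, u₁, -, hu₁, -, -⟩ := hB y h1 h2
      refine ⟨u₁, ⟨hu₁.1, hu₁.2.1⟩, ?_⟩
      exact ((hA u₁ (hlm'.trans hu₁.1) hu₁.2.1 hu₁.1.ne').2.2 y h1 h2 hu₁.2.2.2).symm
  -- the trace identity
  have htr : ∀ t₀ t₁ : ℝ, (lo : ℝ) < t₀ → t₀ < (mid : ℝ) → (mid : ℝ) < t₁ → t₁ < (hi : ℝ) →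
      ψ t₀ = ψ t₁ →
      (fun y => cf * (α + β * y) / Real.sqrt |Ft y|) (ψ t₀) =
        (fun t => cg * (α + β * t) / Real.sqrt |Fs t|) t₀ / |ψ' t₀| +
          (fun t => cg * (α + β * t) / Real.sqrt |Fs t|) t₁ / |ψ' t₁| := by
    intro t₀ t₁ h0l h0m h1m h1h heq
    simp only
    obtain ⟨hroot₀, ⟨hy1, hy2⟩, -⟩ := hA t₀ h0l (h0m.trans hmh') h0m.ne
    obtain ⟨hroot₁, -, -⟩ := hA t₁ (hlm'.trans h1m) h1h h1m.ne'
    set y := ψ t₀ with hy_def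
    rw [← heq] at hroot₁
    -- t₀ < y < t₁ and the Vieta sum
    have hlt₀ : t₀ < y := (hB₀ y t₀ hy1 hy2 h0l h0m hroot₀).1
    have hlt₁ : y < t₁ := (hB₁ y t₁ hy1 hy2 h1m h1h hroot₁).1
    obtain ⟨u₀, u₁, hu₀, hu₁, hsum, hcl⟩ := hB y hy1 hy2
    have e₀ : t₀ = u₀ := by
      rcases hcl t₀ hroot₀ with h | h
      · exact h
      · exfalso; rw [h] at h0m; linarith [hu₁.1]
    have e₁ : t₁ = u₁ := by
      rcases hcl t₁ hroot₁ with h | h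
      · exfalso; rw [h] at h1m; linarith [hu₀.2.1]
      · exact h
    rw [← e₀, ← e₁] at hsum
    -- the abstract trace lemma
    have key := trace_from_certs y t₀ t₁ (P y) (Q y) (Ft y) (Fs t₀) (Fs t₁) (Ψ y t₀) (Ψ y t₁)
      (2 * a t₀ * y + b t₀) (2 * a t₁ * y + b t₁) κ α β (hP y hy1 hy2) hlt₀ hlt₁ hsum
      (hFt y hy1 hy2) (hFs t₀ h0l (h0m.trans hmh') h0m.ne) (hFs t₁ (hlm'.trans h1m) h1h h1m.ne')
      (hnorm y t₀ hroot₀) (hnorm y t₁ hroot₁) (hcert y t₀ hroot₀) (hcert y t₁ hroot₁)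
    -- |ψ′ tⱼ| = |2P tⱼ + Q| / |2a y + b|
    have hψ'abs : ∀ t : ℝ, ψ t = y → |ψ' t| = |2 * P y * t + Q y| / |2 * a t * y + b t| := by
      intro t ht
      simp only [hψ'_def]
      rw [ht, hexp_t, abs_div, abs_neg]
    rw [hψ'abs t₀ rfl, hψ'abs t₁ heq.symm, hq]
    have hden₀ : |2 * a t₀ * y + b t₀| ≠ 0 := by
      rw [hy_def, hψ_def, two_mul_quadRoot_add _ _ _ _ (ha t₀ h0l (h0m.trans hmh')).ne']
      exact abs_ne_zero.mpr (mul_ne_zero hε0 (Real.sqrt_pos.mpr (hd t₀ h0l (h0m.trans hmh') h0m.ne)).ne')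
    have hden₁ : |2 * a t₁ * y + b t₁| ≠ 0 := by
      have : y = ψ t₁ := heq
      rw [this, hψ_def, two_mul_quadRoot_add _ _ _ _ (ha t₁ (hlm'.trans h1m) h1h).ne']
      exact abs_ne_zero.mpr (mul_ne_zero hε0 (Real.sqrt_pos.mpr (hd t₁ (hlm'.trans h1m) h1h h1m.ne')).ne')
    have hnum₀ : |2 * P y * t₀ + Q y| ≠ 0 := by
      have := hn₀ t₀ h0l h0m
      rw [← abs_ne_zero, hψ'abs t₀ rfl] at this
      intro h; rw [h, zero_div] at this; exact this rfl
    have hnum₁ : |2 * P y * t₁ + Q y| ≠ 0 := by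
      have := hn₁ t₁ h1m h1h
      rw [← abs_ne_zero, hψ'abs t₁ heq.symm] at this
      intro h; rw [h, zero_div] at this; exact this rfl
    calc cg * |κ| * (α + β * y) / Real.sqrt |Ft y|
        = cg * (|κ| * (α + β * y) / Real.sqrt |Ft y|) := by ring
      _ = cg * ((α + β * t₀) / Real.sqrt |Fs t₀| * (|2 * a t₀ * y + b t₀| / |2 * P y * t₀ + Q y|) +
            (α + β * t₁) / Real.sqrt |Fs t₁| * (|2 * a t₁ * y + b t₁| / |2 * P y * t₁ + Q y|)) := by
          rw [key]
      _ = cg * (α + β * t₀) / Real.sqrt |Fs t₀| / (|2 * P y * t₀ + Q y| / |2 * a t₀ * y + b t₀|) +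
            cg * (α + β * t₁) / Real.sqrt |Fs t₁| / (|2 * P y * t₁ + Q y| / |2 * a t₁ * y + b t₁|) := by
          field_simp
  -- the two-sheet transfer
  have hsT : s.domain = {q | q 0 ∈ Ioo (y₁ : ℝ) y₂} := by rw [hs]; rfl
  exact two_sheet_transfer r s lo mid hi (Ioo (y₁ : ℝ) y₂)
    (fun t => cg * (α + β * t) / Real.sqrt |Fs t|) (fun y => cf * (α + β * y) / Real.sqrt |Ft y|)
    ψ ψ' ψ ψ' hlm hmh hr hg hsT hf hψ₀ hψ₀' hd₀ hn₀ hi₀ him₀ hψ₁ hψ₁' hd₁ hn₁ hi₁ him₁ htr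

end Summit.KontsevichZagierPeriods.IsogenyCertificates.RichelotChain

end
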